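import Summits.KontsevichZagierPeriods.KontsevichZagierPeriods.Theorems.LiouvilleUnfoldingAyoubPiCancellationSpreadFinishing
import Summits.KontsevichZagierPeriods.KontsevichZagierPeriods.Theorems.LiouvilleUnfoldingAyoubPiCancellationSpreadOfRelation

/-!
# Crux stmt-KontsevichZagierPeriods-0540 (`LiouvilleUnfolding.AyoubPiCancellation` ≡ `KZ.PiCancellation`),
# line `Sketch` (idea `moving-segment-wronskian`): item 0540 ⟺ SPREAD REDUCTION, stub `stub_spreadReductionIff`

Support file (`--supports` stmt-KontsevichZagierPeriods-0540) of the line skeleton (v9, lead seat c1),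
registered stub `stub_spreadReductionIff` (glue of the two landed bookkeeping stubs).

Let `V n r = [{(q, x, y, w) : a < q < b, x² + y² ≤ 1, x < q, w ∈ σ_r}, g_r(w)]` be the pinned
MOVING-SEGMENT SPREAD family over the wall positions `q ∈ (a, b)` (dimension `n + 3`, coordinate
`0 = q`; it exists, `exists_pinnedSpread`, and is unique by `KZ.IntegralRep.ext'`). The statement

  (B)  `∀ c, [π]·c ∈ relations → ∃ -1 ≤ a < b ≤ 1, ∀ V pinned over (a, b), lift (of ∘ V) c ∈ fibredRelations`

("the spread of `c` is annihilated UNIFORMLY in the wall position on some interval") is EQUIVALENT to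
`KZ.PiCancellation` (`fluxFamilyVanishing_iff_piCancellation`) and to the filed crux
`AyoubSpecialisation.AyoubPiCancellation` (`stub_spreadReductionIff`): "⟹" by SPREAD FINISHING on the
middle third of `(a, b)` (`stub_spreadFinishing`, p153037: zero-mean `q`-weight multiplier, no
derivative engine); "⟸" because a relation has `q`-fibred spread over every interval
(`stub_spreadOfRelation`, p153694), applied on `(0, 1)`. Consequently the line `Sketch` is closed modulo
its stub (B) `stub_fluxFamilyVanishing`, and (B) is the crux itself, not a weakening.
No definitions; sorry-free; axioms ⊆ {propext, Classical.choice, Quot.sound}.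

References: M. Kontsevich, D. Zagier, *Periods* (2001), §1.2, §4.1; J. Ayoub, *Une version relative de
la conjecture des périodes de Kontsevich–Zagier*, Ann. of Math. 181 (2015), §1; A. Huber,
G. Wüstholz, *Transcendence and linear relations of 1-periods* (2022), App. A.4.
-/

noncomputable section

-- `Summit.KontsevichZagierPeriods.KontsevichZagierPeriods.…` is the tree's mandated layout (single-conjunct summit).
set_option linter.dupNamespace false

namespace Summit.KontsevichZagierPeriods.KontsevichZagierPeriods.AyoubPiCancellationLine

open Set MeasureTheory
open Literature.NumberTheory.Transcendental
open Literature.NumberTheory.Transcendental.KZ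

/-- **The pinned spread family exists**: `V n r := ([spread solid, 1] × r).reindex
(Fin (3 + n) ≃ Fin (n + 3))`. [folklore] -/
theorem exists_pinnedSpread (a b : ℚ) :
    ∃ V : ∀ n : ℕ, IntegralRep n → IntegralRep (n + 3), ∀ (n : ℕ) (r : IntegralRep n),
      (V n r).domain = {z : Fin (n + 3) → ℝ | ((a : ℝ) < z 0 ∧ z 0 < b) ∧ z 1 ^ 2 + z 2 ^ 2 ≤ 1 ∧
        z 1 < z 0 ∧ (fun i : Fin n => z i.succ.succ.succ) ∈ r.domain} ∧
      (V n r).integrand = fun z => r.integrand (fun i : Fin n => z i.succ.succ.succ) := by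
  obtain ⟨X, hXd, hXi⟩ := exists_spreadSolidOne a b
  refine ⟨fun n r => (X.prod r).reindex (finCongr (Nat.add_comm 3 n)), fun n r => ⟨?_, ?_⟩⟩
  · ext z
    simp only [IntegralRep.reindex_domain, IntegralRep.prod_domain, IntegralRep.mem_prodDomain, hXd,
      mem_setOf_eq, spreadLift_idx_castAdd_zero, spreadLift_idx_castAdd_one,
      spreadLift_idx_castAdd_two, spreadLift_idx_natAdd, and_assoc]
  · funext z
    simp only [IntegralRep.reindex_integrand, IntegralRep.prod_integrand_eq, IntegralRep.prodFun,
      hXi, one_mul, spreadLift_idx_natAdd]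

/-- **(B) ⟺ `KZ.PiCancellation`** (from the two landed bookkeeping stubs): the flux-family statement
`stub_fluxFamilyVanishing` is EQUIVALENT to the crux — "⟸": a relation `c` has `q`-fibred spread
(`stub_spreadOfRelation`, on the wall interval `(0, 1)`); "⟹": spread finishing on the middle third
(`stub_spreadFinishing`). So (B) is crux-strength by a tree theorem, not by belief. [folklore] -/
theorem fluxFamilyVanishing_iff_piCancellation :
    (∀ c : FormalRep, of piRep * c ∈ relations →
      ∃ a b : ℚ, -1 ≤ a ∧ a < b ∧ b ≤ 1 ∧
        ∀ (V : ∀ n : ℕ, IntegralRep n → IntegralRep (n + 3)),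
          (∀ (n : ℕ) (r : IntegralRep n),
            (V n r).domain = {z : Fin (n + 3) → ℝ | ((a : ℝ) < z 0 ∧ z 0 < b) ∧ z 1 ^ 2 + z 2 ^ 2 ≤ 1 ∧
              z 1 < z 0 ∧ (fun i : Fin n => z i.succ.succ.succ) ∈ r.domain} ∧
            (V n r).integrand = fun z => r.integrand (fun i : Fin n => z i.succ.succ.succ)) →
          FreeAbelianGroup.lift (fun s : (Σ n, IntegralRep n) => of (V s.1 s.2)) c ∈ fibredRelations) ↔
    PiCancellation := by
  constructor
  · intro hB c hc
    obtain ⟨a, b, ha, hab, hb, hVall⟩ := hB c hc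
    obtain ⟨V, hV⟩ := exists_pinnedSpread a b
    have h1 : a < (2 * a + b) / 3 := by linarith
    have h2 : (2 * a + b) / 3 < (a + 2 * b) / 3 := by linarith
    have h3 : (a + 2 * b) / 3 < b := by linarith
    have h4 : (-1 : ℚ) < (2 * a + b) / 3 := by linarith
    have h5 : (a + 2 * b) / 3 < (1 : ℚ) := by linarith
    exact stub_spreadFinishing a b _ _ h1 h2 h3 h4 h5 V hV c (hVall V hV)
  · intro hP c hc
    exact ⟨0, 1, by norm_num, by norm_num, le_rfl, fun V hV => stub_spreadOfRelation 0 1 V hV c (hP c hc)⟩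

/-- **STUB `stub_spreadReductionIff` — item 0540 ⟺ SPREAD REDUCTION, i.e. (B) ⟺ the crux in its
filed typing**: `AyoubPiCancellation` holds iff every `c` with `[π]·c ∈ relations` has its moving-segment
spread annihilated uniformly (a `q`-fibred relation) on some interval of wall positions. The line's one
open stub `stub_fluxFamilyVanishing` is therefore EXACTLY the crux (open in print: Huber–Wüstholz 2022,
App. A.4). [folklore] -/
theorem stub_spreadReductionIff :
    (∀ c : FormalRep, of piRep * c ∈ relations →
      ∃ a b : ℚ, -1 ≤ a ∧ a < b ∧ b ≤ 1 ∧
        ∀ (V : ∀ n : ℕ, IntegralRep n → IntegralRep (n + 3)),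
          (∀ (n : ℕ) (r : IntegralRep n),
            (V n r).domain = {z : Fin (n + 3) → ℝ | ((a : ℝ) < z 0 ∧ z 0 < b) ∧ z 1 ^ 2 + z 2 ^ 2 ≤ 1 ∧
              z 1 < z 0 ∧ (fun i : Fin n => z i.succ.succ.succ) ∈ r.domain} ∧
            (V n r).integrand = fun z => r.integrand (fun i : Fin n => z i.succ.succ.succ)) →
          FreeAbelianGroup.lift (fun s : (Σ n, IntegralRep n) => of (V s.1 s.2)) c ∈ fibredRelations) ↔
    Summit.KontsevichZagierPeriods.KontsevichZagierPeriods.Theses.AyoubSpecialisation.AyoubPiCancellation :=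
  fluxFamilyVanishing_iff_piCancellation.trans
    Summit.KontsevichZagierPeriods.KontsevichZagierPeriods.BetaCancellationLine.stub_ayoubBridge.symm

end Summit.KontsevichZagierPeriods.KontsevichZagierPeriods.AyoubPiCancellationLine
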